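import Summits.Langlands.Langlands.Theorems.SoloInformedRepairR3plus
import Literature.NumberTheory.Automorphic.LocalLanglandsGLOne

/-!
# R3⁺, the case `n = 1`: the `GL₁` correspondence is `𝓡`-independent unconditionally

Summit `Langlands` (`Summits/Langlands/Langlands/Statement`); companion to
`Theorems/SoloInformedRepairR3plus` (the re-scoped summit shape `LanglandsR3plus`: Satake parameters
almost everywhere, local–global compatibility at every `v ∤ ℓ`, de Rham + labelled Hodge–Tate weights
at every `v ∣ ℓ`) and `Theorems/SoloInformedRepairR3plusRecIndependence`
(`globalLanglandsCorrespondenceGLnR3plus_iff`: for `GL_n/K` the R3⁺ correspondence is `𝓡`-independent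
GIVEN agreement of the two reciprocity data on the local components of L-algebraic cuspidal `π`).

For `n = 1` that agreement hypothesis is a THEOREM for any two reciprocity data and any class: both
data are normalised against the same local Artin map at every place (the pin
`ReciprocityData.artin_eq`; the remaining fields of `LocalArtinData` are propositions), and the
degree-one map of a local Langlands datum IS local class field theory against that map
(`IsLocalLanglandsGL.rec_one_eq_recGLOne`, Harris–Taylor 2001, Thm. A (i)).  Hence, with NO hypothesis:
`correspondsR3plus_one_iff` (`CorrespondsR3plus 𝓡 ι π ρ ↔ CorrespondsR3plus 𝓡' ι π ρ` for every
automorphic `π` of `GL₁(𝔸_K)` and every `1`-dimensional `ρ`), `automorphicToGaloisR3plus_one_iff`,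
`galoisToAutomorphicR3plus_one_iff`, `globalLanglandsCorrespondenceGLnR3plus_one_iff` (the exact R3⁺
analogue of `globalLanglandsCorrespondenceGLn_one_iff` of `Theorems/SoloInformedRecIndependence`) and
`globalLanglandsCorrespondenceGLnR3plus_one_of_exists` (for `GL₁` the `∃ 𝓡` form gives the `∀ 𝓡`
form).  `Theorems/SoloInformedRepairR3plusRecIndependence` and `Theorems/SoloInformedRecIndependence`
are not imported (their closures were unbuilt on the farm when this file was written); the two-line
lemma `rec₁(𝓡) = rec₁(𝓡')` is re-derived inline.  Pure logic over the tree; no new mathematics, no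
definitions.  Soloist file (`solo-Langlands-informed`, s52).
-/

noncomputable section

open scoped MatrixGroups Matrix Classical NumberField
open NumberField IsDedekindDomain Filter
open Literature.NumberTheory.Automorphic Literature.NumberTheory.GaloisRepresentations

namespace Summit.Langlands.Langlands.Theorems

namespace R3plus

open Summit.Langlands

variable {K : Type} [Field K] [NumberField K] {hcpt : isCompact_glFiniteIntegralLevel 1 K}
  {ℓ : ℕ} [Fact ℓ.Prime]

/-- **For `GL₁`, `CorrespondsR3plus` does not depend on `𝓡` at all**: the only `𝓡`-dependence is
through `rec₁` on the local components inside `LocalGlobalCompatibleAt`, and any two reciprocity data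
have the same `rec₁` at every finite place (Artin pin + `rec₁` = local class field theory,
Harris–Taylor Thm. A (i)). [folklore] -/
theorem correspondsR3plus_one_iff (𝓡 𝓡' : ReciprocityData K) {ι : PadicAlgCl ℓ ≃+* ℂ}
    {π : AutomorphicRepData (AutomorphyDatum.gl 1 K hcpt)} {ρ : FramedGaloisRep K (PadicAlgCl ℓ) 1} :
    CorrespondsR3plus 𝓡 ι π ρ ↔ CorrespondsR3plus 𝓡' ι π ρ := by
  -- `rec₁(𝓡) = rec₁(𝓡')` at every finite place
  have hrec : ∀ v : HeightOneSpectrum (𝓞 K), (𝓡.llc v).recGL 1 = (𝓡'.llc v).recGL 1 := by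
    intro v
    -- the pinned local Artin DATA agree: equal Artin homomorphisms, all other fields propositions
    have key : ∀ {d d' : LocalArtinData (v.adicCompletion K)}, d.artin = d'.artin → d = d' := by
      intro d d' h
      cases d
      cases d'
      cases h
      rfl
    rw [(𝓡.llc v).isLocalLanglands.rec_one_eq_recGLOne,
      (𝓡'.llc v).isLocalLanglands.rec_one_eq_recGLOne, key (𝓡.artin_eq 𝓡' v)]
  have hLGC : ∀ v : HeightOneSpectrum (𝓞 K),
      LocalGlobalCompatibleAt 𝓡 ι π ρ v ↔ LocalGlobalCompatibleAt 𝓡' ι π ρ v := by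
    intro v
    constructor
    · rintro ⟨πv, r, rℂ, hloc, h₁, h₂, h₃, h₄⟩
      exact ⟨πv, r, rℂ, hloc, h₁, h₂, h₃, congrFun (hrec v) (IrrClass.mk πv) ▸ h₄⟩
    · rintro ⟨πv, r, rℂ, hloc, h₁, h₂, h₃, h₄⟩
      exact ⟨πv, r, rℂ, hloc, h₁, h₂, h₃, (congrFun (hrec v) (IrrClass.mk πv)).symm ▸ h₄⟩
  exact and_congr Iff.rfl
    (and_congr (forall_congr' fun v ↦ forall_congr' fun _ ↦ hLGC v) Iff.rfl)

/-- Direction (A), R3⁺ form, is `𝓡`-independent for `GL₁`, unconditionally. [folklore] -/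
theorem automorphicToGaloisR3plus_one_iff (𝓡 𝓡' : ReciprocityData K)
    (hcpt : isCompact_glFiniteIntegralLevel 1 K) :
    AutomorphicToGaloisR3plus 1 𝓡 hcpt ↔ AutomorphicToGaloisR3plus 1 𝓡' hcpt := by
  refine forall_congr' fun π ↦ forall_congr' fun hπ ↦ forall_congr' fun ℓ ↦
    forall_congr' fun _ ↦ forall_congr' fun ι ↦ exists_congr fun ρ ↦ ?_
  have hG : IsGeometricFramed 𝓡 ρ ↔ IsGeometricFramed 𝓡' ρ := Iff.rfl
  rw [hG, correspondsR3plus_one_iff 𝓡 𝓡']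
  refine and_congr Iff.rfl (and_congr Iff.rfl (and_congr Iff.rfl (forall_congr' fun ρ' ↦ ?_)))
  rw [correspondsR3plus_one_iff 𝓡 𝓡']

/-- Direction (B), R3⁺ form, is `𝓡`-independent for `GL₁`, unconditionally. [folklore] -/
theorem galoisToAutomorphicR3plus_one_iff (𝓡 𝓡' : ReciprocityData K)
    (hcpt : isCompact_glFiniteIntegralLevel 1 K) :
    GaloisToAutomorphicR3plus 1 𝓡 hcpt ↔ GaloisToAutomorphicR3plus 1 𝓡' hcpt := by
  refine forall_congr' fun ℓ ↦ forall_congr' fun _ ↦ forall_congr' fun ι ↦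
    forall_congr' fun ρ ↦ forall_congr' fun _ ↦ ?_
  have hG : IsGeometricFramed 𝓡 ρ ↔ IsGeometricFramed 𝓡' ρ := Iff.rfl
  rw [hG]
  refine forall_congr' fun _ ↦ exists_congr fun π ↦ ?_
  constructor
  · rintro ⟨hπ, hc⟩
    exact ⟨hπ, (correspondsR3plus_one_iff 𝓡 𝓡').1 hc⟩
  · rintro ⟨hπ, hc⟩
    exact ⟨hπ, (correspondsR3plus_one_iff 𝓡 𝓡').2 hc⟩

/-- **The `GL₁` case of the R3⁺ correspondence is `𝓡`-independent**, unconditionally — the exact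
R3⁺ analogue of `globalLanglandsCorrespondenceGLn_one_iff`. [folklore] -/
theorem globalLanglandsCorrespondenceGLnR3plus_one_iff (𝓡 𝓡' : ReciprocityData K)
    (hcpt : isCompact_glFiniteIntegralLevel 1 K) :
    GlobalLanglandsCorrespondenceGLnR3plus 1 K 𝓡 hcpt ↔
      GlobalLanglandsCorrespondenceGLnR3plus 1 K 𝓡' hcpt :=
  and_congr (automorphicToGaloisR3plus_one_iff 𝓡 𝓡' hcpt)
    (galoisToAutomorphicR3plus_one_iff 𝓡 𝓡' hcpt)

/-- For `GL₁` the `∃ 𝓡` form of the R3⁺ correspondence gives the `∀ 𝓡` form with no hypothesis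
(for general `n` this is `langlandsR3plus_iff_exists` under (U_occ)). [folklore] -/
theorem globalLanglandsCorrespondenceGLnR3plus_one_of_exists
    (hcpt : isCompact_glFiniteIntegralLevel 1 K)
    (h : ∃ 𝓡 : ReciprocityData K, GlobalLanglandsCorrespondenceGLnR3plus 1 K 𝓡 hcpt)
    (𝓡' : ReciprocityData K) : GlobalLanglandsCorrespondenceGLnR3plus 1 K 𝓡' hcpt := by
  obtain ⟨𝓡, h𝓡⟩ := h
  exact (globalLanglandsCorrespondenceGLnR3plus_one_iff 𝓡 𝓡' hcpt).1 h𝓡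

end R3plus

end Summit.Langlands.Langlands.Theorems

end
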